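import Literature.MathematicalPhysics.QuantumFieldTheory.Balaban1983to89.DagDischargedII
import Literature.MathematicalPhysics.QuantumFieldTheory.Balaban1983to89.B11Prop7Assembly
import Literature.MathematicalPhysics.QuantumFieldTheory.Balaban1983to89.B11Thm1TwoTier

/-!
# `Balaban1983to89.B11LeafKnitTwoTier` — T. Bałaban, *The variational problem and background fields in renormalization group
# method for lattice gauge theories*, Commun. Math. Phys. **102** (1985) 277–309, doi:10.1007/bf01229381
# [Balaban1985Variational]: **the B11 leaf and the DAG node N07 over the REPAIRED scale tower** (`B11Thm1TwoTier.TowerT`: two-tier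
# hypothesis (7″), gauge-covariant V₀, approximate boundary averages — cell GAPS G-B11-A1b, repair route R1), composing
# `B11Thm1TwoTier.thm1TAt_allLevels` / `background_of_thm1TAt` (unit b2b-balaban-b11-g4) with `B11Prop7Assembly.prop7From14_of_props_cap`
# (reader r08) BY NAME; Theorem 1 comes out with B₃″ = κ₀B₃ and the background-free Proposition 7 at B₃″, so the leaf is knit AT B₃″

statement-level bookkeeping over published theorems with citation tags; proofs = kernel composition of landed modules BY NAME; nothing here
is a claim about the Yang–Mills mass gap

PDF held: `paper:balaban1985-cmp102-variational-background` (journal page = PDF page + 276).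

CITATION HEADER (lean-in-tree rule 2026-08-18) / WHAT IS REPRODUCED.  Cell `pub-ymgap`, Track A node N07 = [B11] (statement of record
`YMDAG.N07 w P := Dag.B11_main (DagBinding.leavesP w P)`, own leaf `b11 ↦ DagBinding.B11Leaf Z`), prover seat `pub-ymgap-dag-n07-a`
(KNIT-BY-NAME), third module; sibling of `B11LeafKnit` (arbitrary bundle, Sect. A law a hypothesis for small ε₁) and `B11LeafKnitTower`
(printed tower `B11Thm1.Tower`, whose leaf `StepA11` — (11) ⇒ (7) for the printed V₀ — is REFUTED in the multi-domain case, cell GAPS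
G-B11-A1b, `B11V0Interface`).  A NEW LEAF over `DagDischargedII`, `B11Prop7Assembly`, `B11Thm1TwoTier`; nothing there is modified; NO
definition is introduced (theorems only; the B11 bundle is a structure literal of `DagBinding.PrintedCarriers11`).
THE OBJECTS.  `T : B11Thm1TwoTier.TowerT` = pv12's scale tower + (κ₀, C′₁, the two-tier class `RegT` = (7″), the covariant `V0c`);
`famD p : B11.LGData` = the Sect. A–E description of the problem `p = ⟨n, i⟩`, bridged by `β p : B11Prop7Assembly.Bridge` ((15) p. 280) and
`bg p` («a configuration read as a background»), law `hbg14` = (14) p. 280 read on both carriers (DIVERGENCE D-pv12.2), at the background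
constant C₁ ≥ max(L³, C′₁) (p. 302: *"for the purpose of the proof of the regularity properties we can take C₁ = L³"*).
§1 `prop7From14_towerT`: pv12's leaf `Prop7From14 T.toTower B₃ C₁` from Props 2, 5, 6 on the Sect. A–E family over all levels
   (`B11Prop7Assembly.prop7From14_of_props_cap`, p. 296 (122), p. 299 (141)–(142)).
§2 `thm1TAt_towerT_of_parts`, `thm1Printed_towerT_of_parts`: Theorem 1″ (hypothesis (7″)) hence Theorem 1 at every level ∕ over all levels
   with ONE block of constants, B₃″ = B₃κ₀ — `B11Thm1TwoTier.thm1TAt_allLevels` ∕ `thm1Printed_allLevels_twoTier` BY NAME fed with §1.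
§3 `prop7Printed_towerT_of_parts`: the printed background-free Proposition 7 over all levels AT (B₃κ₀, C₁), from `Prop7From14` at the
   parameter κ₀ε₁ and the repaired background supply `B11Thm1TwoTier.background_of_thm1TAt` (ε₁ ≤ a₁″), with a₀ ↦ min{a₀, B₃κ₀a₁″},
   a′₁ ↦ min{a′₁/κ₀, a₁″}.  TYPED OBSERVATION: at the Sect.-F constant B₃ itself the background-free Proposition 7 is NOT delivered by the
   repaired induction (backgrounds come at the parameter κ₀ε₁), only at B₃″ = κ₀B₃ — the constant at which the repaired Theorem 1 holds.
§4 `b11Leaf_towerT_of_parts`, `b11_main_towerT_of_parts`: the B11 leaf of the tower bundle AT B₃″ = κ₀B₃ and the node N07 at a run bound to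
   it.  Because `DagBinding.B11Leaf` shares ONE B₃ among Props 2–8 and Sect. F, the leaf's instances of Props 2, 3, 4, 5, 6, 8, Sect. F are
   taken at B₃″ (hypotheses `q2 … qF`), while the induction consumes Props 2, 5, 6, 8, Sect. F at B₃ (hypotheses `p2 p5 p6 p8 sF`): two
   instances of the same B₃-generic typed statements (every tree inhabitant — `B11Prop5Model.prop5Printed_model`,
   `B11Prop6Model.prop6Printed_model`, `B11SectFAssembly.sectFPrinted_of_leaves`, … — is stated for arbitrary B₃ > 0).
HYPOTHESES THAT ARE NOT PRINTED STATEMENTS (dictionary ∕ located readings, never asserted): `TowerT.ClassLaws`, `VarProblemA.LawsA`,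
`Bridge.Laws`, `ExistenceLeavesCap`, `hbg14`, the repaired leaves `StepA11T`, `StepA13T`, `BaseK1T` (content: cell record V0-REPAIR.md,
GAPS G-B11-A1d ∕ G-B11-A2), and the printed constant relations B₀ ≤ 4B₁, B₃ ≥ 1, L³ ≤ C₁, C′₁ ≤ C₁.  **Prop 9 `B11.Prop9Printed`: NO
inhabitant in the tree** (GAPS G-B11-G2).
HONEST FRAMING: a count-neutral Track-A side landing (YM-PLAN §1); NOT a discharge of node N07 (the B11 group is FREE at NODE 00 Stages 1–3,
`Node00.IsWorldOfRecord₃`); one finite T⁴ programme at fixed ε; Bałaban AS PRINTED with page locators (the repair labelled as such);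
nothing continuum ∕ ℝ⁴ ∕ OS ∕ mass-gap ∕ Clay.
-/

namespace Literature.MathematicalPhysics.QuantumFieldTheory.Balaban1983to89.B11LeafKnitTwoTier

open Literature.MathematicalPhysics.QuantumFieldTheory.Balaban1983to89
open Literature.MathematicalPhysics.QuantumFieldTheory.Balaban1983to89.B11
open Literature.MathematicalPhysics.QuantumFieldTheory.Balaban1983to89.B11Thm1
open Literature.MathematicalPhysics.QuantumFieldTheory.Balaban1983to89.B11Thm1TwoTier
open Literature.MathematicalPhysics.QuantumFieldTheory.Balaban1983to89.DagBinding
open Literature.MathematicalPhysics.QuantumFieldTheory.Balaban1983to89.B11Prop7Assembly (Bridge ExistenceLeavesCap)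

variable (T : TowerT) (famD : (Σ n, T.I n) → LGData) (β : ∀ p : Σ n, T.I n, Bridge (T.famAllX p) (famD p))
  (bg : ∀ p : Σ n, T.I n, (T.fam p.1 p.2).Cfg → (famD p).Cfg)

/-! ## §1. Proposition 7 from a background, uniformly over the repaired tower, from Props 2, 5, 6 -/

/-- **pv12's leaf `Prop7From14 T.toTower B₃ C₁`** (Proposition 7 from a background U₀ with (14) at constant C₁, every level, one block of
constants) from Propositions 2, 5, 6 on the Sect. A–E family over all levels — `B11Prop7Assembly.prop7From14_of_props_cap` BY NAME, the
background read on the Sect. A–E carrier through `hbg14`. [cite: Balaban1985Variational, Prop. 7 p.299; (14) p.280; (122) p.296] -/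
theorem prop7From14_towerT {B₀ B₁ B₃ C₁ c₁ O₁ O₂ e₅ : ℝ}
    (hbg14 : ∀ (p : Σ n, T.I n) (ε : ℝ) (V : (T.fam p.1 p.2).Bdry) (U : (T.fam p.1 p.2).Cfg),
      (T.fam p.1 p.2).Sat14 C₁ B₃ ε V U → (famD p).Sat14 (C₁ * B₃ * ε) (C₁ * ε) ((β p).bdry V) (bg p U))
    (laws : ∀ p, (β p).Laws C₁ B₃) (leaves : ∀ p, ExistenceLeavesCap (β p) B₀ B₃ C₁ O₁ O₂ e₅)
    (hB₀ : 0 < B₀) (hB₁ : 0 < B₁) (hB₃ : 1 ≤ B₃) (hC₁ : 1 ≤ C₁) (hB₀B₁ : B₀ ≤ 4 * B₁) (hc₁ : 0 < c₁)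
    (hO₁ : 0 < O₁) (hO₂ : 0 < O₂) (he₅ : 0 < e₅)
    (p2 : Prop2Printed B₁ B₃ C₁ c₁ famD) (p5 : Prop5Printed B₁ B₃ C₁ famD) (p6 : Prop6Printed B₀ B₃ C₁ famD) :
    Prop7From14 T.toTower B₃ C₁ := by
  obtain ⟨a₀, a₁', O, ha₀, ha₁', hO, H⟩ :=
    B11Prop7Assembly.prop7From14_of_props_cap β laws leaves hB₀ hB₁ hB₃ hC₁ hB₀B₁ hc₁ hO₁ hO₂ he₅ p2 p5 p6
  refine ⟨a₀, a₁', O, ha₀, ha₁', hO, fun n i ε₀ ε₁ hε₁ V hV U₀ h14 => ?_⟩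
  exact H ⟨n, i⟩ ε₀ ε₁ hε₁ V hV (bg ⟨n, i⟩ U₀) (hbg14 ⟨n, i⟩ ε₁ V U₀ h14)

/-! ## §2. Theorem 1″ and Theorem 1 at every level of the repaired tower from the parts -/

/-- **Theorem 1″ at every level, one block of constants, B₃″ = B₃κ₀** — `B11Thm1TwoTier.thm1TAt_allLevels` BY NAME, its input `Prop7From14`
supplied by `prop7From14_towerT`: from Props 2, 5, 6 (Sect. A–E family), Prop 8 and Sect. F (over all levels) at the Sect.-F constant B₃,
the class laws of (7″), the repaired Sect. A leaves and the dictionary. [cite: Balaban1985Variational, Thm 1 p.279; Sect. A pp.279–280] -/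
theorem thm1TAt_towerT_of_parts {B₀ B₁ B₃ C₁ c₁ O₁ O₂ e₅ : ℝ}
    (hbg14 : ∀ (p : Σ n, T.I n) (ε : ℝ) (V : (T.fam p.1 p.2).Bdry) (U : (T.fam p.1 p.2).Cfg),
      (T.fam p.1 p.2).Sat14 C₁ B₃ ε V U → (famD p).Sat14 (C₁ * B₃ * ε) (C₁ * ε) ((β p).bdry V) (bg p U))
    (laws : ∀ p, (β p).Laws C₁ B₃) (leaves : ∀ p, ExistenceLeavesCap (β p) B₀ B₃ C₁ O₁ O₂ e₅)
    (cl : T.ClassLaws) (lawsA : ∀ n i, (T.fam n i).LawsA) (hA11 : StepA11T T) (hA13 : StepA13T T) (hK1 : BaseK1T T B₃ C₁)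
    (hB₀ : 0 < B₀) (hB₁ : 0 < B₁) (hB₃ : 1 ≤ B₃) (hL : 1 ≤ T.L) (hC₁L : T.L ^ 3 ≤ C₁) (hC₁' : T.C₁' ≤ C₁)
    (hB₀B₁ : B₀ ≤ 4 * B₁) (hc₁ : 0 < c₁) (hO₁ : 0 < O₁) (hO₂ : 0 < O₂) (he₅ : 0 < e₅)
    (p2 : Prop2Printed B₁ B₃ C₁ c₁ famD) (p5 : Prop5Printed B₁ B₃ C₁ famD) (p6 : Prop6Printed B₀ B₃ C₁ famD)
    (p8 : Prop8Printed B₃ T.famAllX) (sF : SectFPrinted B₃ T.famAllX) :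
    ∃ C : B11Thm1.Consts, C.B₃ = B₃ * T.κ₀ ∧ ∀ (n : ℕ) (i : T.I n), Thm1TAt T C n i :=
  thm1TAt_allLevels T B₃ C₁ (lt_of_lt_of_le one_pos hB₃) hL hC₁L hC₁' cl lawsA hA11 hA13 hK1
    (prop7From14_towerT T famD β bg hbg14 laws leaves hB₀ hB₁ hB₃ ((one_le_pow₀ hL).trans hC₁L) hB₀B₁ hc₁ hO₁ hO₂ he₅
      p2 p5 p6) p8 sF

/-- **Theorem 1 as printed over all levels of the repaired tower** (`B11.Thm1Printed T.famAll`; constants uniform in k, B₃″ = B₃κ₀) —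
`B11Thm1TwoTier.thm1Printed_allLevels_twoTier` BY NAME. [cite: Balaban1985Variational, Thm 1 p.279] -/
theorem thm1Printed_towerT_of_parts {B₀ B₁ B₃ C₁ c₁ O₁ O₂ e₅ : ℝ}
    (hbg14 : ∀ (p : Σ n, T.I n) (ε : ℝ) (V : (T.fam p.1 p.2).Bdry) (U : (T.fam p.1 p.2).Cfg),
      (T.fam p.1 p.2).Sat14 C₁ B₃ ε V U → (famD p).Sat14 (C₁ * B₃ * ε) (C₁ * ε) ((β p).bdry V) (bg p U))
    (laws : ∀ p, (β p).Laws C₁ B₃) (leaves : ∀ p, ExistenceLeavesCap (β p) B₀ B₃ C₁ O₁ O₂ e₅)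
    (cl : T.ClassLaws) (lawsA : ∀ n i, (T.fam n i).LawsA) (hA11 : StepA11T T) (hA13 : StepA13T T) (hK1 : BaseK1T T B₃ C₁)
    (hB₀ : 0 < B₀) (hB₁ : 0 < B₁) (hB₃ : 1 ≤ B₃) (hL : 1 ≤ T.L) (hC₁L : T.L ^ 3 ≤ C₁) (hC₁' : T.C₁' ≤ C₁)
    (hB₀B₁ : B₀ ≤ 4 * B₁) (hc₁ : 0 < c₁) (hO₁ : 0 < O₁) (hO₂ : 0 < O₂) (he₅ : 0 < e₅)
    (p2 : Prop2Printed B₁ B₃ C₁ c₁ famD) (p5 : Prop5Printed B₁ B₃ C₁ famD) (p6 : Prop6Printed B₀ B₃ C₁ famD)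
    (p8 : Prop8Printed B₃ T.famAllX) (sF : SectFPrinted B₃ T.famAllX) :
    Thm1Printed T.famAll :=
  thm1Printed_allLevels_twoTier T B₃ C₁ (lt_of_lt_of_le one_pos hB₃) hL hC₁L hC₁' cl lawsA hA11 hA13 hK1
    (prop7From14_towerT T famD β bg hbg14 laws leaves hB₀ hB₁ hB₃ ((one_le_pow₀ hL).trans hC₁L) hB₀B₁ hc₁ hO₁ hO₂ he₅
      p2 p5 p6) p8 sF

/-! ## §3. The printed Proposition 7 at B₃″ = κ₀B₃ as a consequence of the repaired induction -/

/-- **The printed (background-free) Proposition 7 over all levels AT (B₃κ₀, C₁)**: backgrounds come from the repaired induction at the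
parameter κ₀ε₁ for ε₁ ≤ a₁″ (`B11Thm1TwoTier.background_of_thm1TAt`), so pv12's `Prop7From14` read at κ₀ε₁ gives clause (i) under
B₃κ₀ε₁ ≤ ε₀ ≤ min{a₀, B₃κ₀a₁″} and clause (ii) for ε₁ ≤ min{a′₁/κ₀, a₁″} with ε₀ = O(1)C₁(B₃κ₀)ε₁ (cell GAPS G-pv12-1: Proposition 7 is a
node INSIDE the induction). [cite: Balaban1985Variational, Prop. 7 p.299; (11)–(14) pp.279–280] -/
theorem prop7Printed_towerT_of_parts {B₀ B₁ B₃ C₁ c₁ O₁ O₂ e₅ : ℝ}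
    (hbg14 : ∀ (p : Σ n, T.I n) (ε : ℝ) (V : (T.fam p.1 p.2).Bdry) (U : (T.fam p.1 p.2).Cfg),
      (T.fam p.1 p.2).Sat14 C₁ B₃ ε V U → (famD p).Sat14 (C₁ * B₃ * ε) (C₁ * ε) ((β p).bdry V) (bg p U))
    (laws : ∀ p, (β p).Laws C₁ B₃) (leaves : ∀ p, ExistenceLeavesCap (β p) B₀ B₃ C₁ O₁ O₂ e₅)
    (cl : T.ClassLaws) (lawsA : ∀ n i, (T.fam n i).LawsA) (hA11 : StepA11T T) (hA13 : StepA13T T) (hK1 : BaseK1T T B₃ C₁)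
    (hB₀ : 0 < B₀) (hB₁ : 0 < B₁) (hB₃ : 1 ≤ B₃) (hL : 1 ≤ T.L) (hC₁L : T.L ^ 3 ≤ C₁) (hC₁' : T.C₁' ≤ C₁)
    (hB₀B₁ : B₀ ≤ 4 * B₁) (hc₁ : 0 < c₁) (hO₁ : 0 < O₁) (hO₂ : 0 < O₂) (he₅ : 0 < e₅)
    (p2 : Prop2Printed B₁ B₃ C₁ c₁ famD) (p5 : Prop5Printed B₁ B₃ C₁ famD) (p6 : Prop6Printed B₀ B₃ C₁ famD)
    (p8 : Prop8Printed B₃ T.famAllX) (sF : SectFPrinted B₃ T.famAllX) :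
    Prop7Printed (B₃ * T.κ₀) C₁ T.famAllX := by
  have hB₃pos : 0 < B₃ := lt_of_lt_of_le one_pos hB₃
  have hC₁ : 1 ≤ C₁ := (one_le_pow₀ hL).trans hC₁L
  have h7 : Prop7From14 T.toTower B₃ C₁ :=
    prop7From14_towerT T famD β bg hbg14 laws leaves hB₀ hB₁ hB₃ hC₁ hB₀B₁ hc₁ hO₁ hO₂ he₅ p2 p5 p6
  obtain ⟨C, hCB, HT⟩ := thm1TAt_allLevels T B₃ C₁ hB₃pos hL hC₁L hC₁' cl lawsA hA11 hA13 hK1 h7 p8 sF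
  obtain ⟨a₀, a₁', O, ha₀, ha₁', hO, H⟩ := h7
  have hκ₀ : 1 ≤ T.κ₀ := cl.1
  have hReg7T := cl.2.2.1
  have hRegT7 := cl.2.2.2.1
  have hκ₀pos : 0 < T.κ₀ := lt_of_lt_of_le one_pos hκ₀
  have hCBpos : 0 < C.B₃ := by rw [hCB]; positivity
  have hdiv : C.B₃ / T.κ₀ = B₃ := by rw [hCB]; field_simp
  have hK1' : BaseK1T T (C.B₃ / T.κ₀) C₁ := by rw [hdiv]; exact hK1
  -- the repaired background supply, for ε₁ ≤ a₁″, at the parameter κ₀ε₁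
  have Hbg : ∀ (n : ℕ) (i : T.I n) (ε₁ : ℝ), 0 < ε₁ → ε₁ ≤ C.a₁ → ∀ V : (T.fam n i).Bdry, (T.fam n i).Reg7 ε₁ V →
      ∃ U₀ : (T.fam n i).Cfg, (T.fam n i).Sat14 C₁ B₃ (T.κ₀ * ε₁) V U₀ := by
    intro n i ε₁ hε₁ hε₁a V hV
    have h := background_of_thm1TAt T C C₁ lawsA cl hC₁L hC₁' hL hCBpos hA11 hA13 hK1' HT n i ε₁ hε₁ hε₁a V
      (hReg7T n i ε₁ V hV)
    rwa [hdiv] at h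
  have hBκ : 0 < B₃ * T.κ₀ := mul_pos hB₃pos hκ₀pos
  refine ⟨min a₀ (B₃ * T.κ₀ * C.a₁), min (a₁' / T.κ₀) C.a₁, O, lt_min ha₀ (mul_pos hBκ C.a₁_pos),
    lt_min (div_pos ha₁' hκ₀pos) C.a₁_pos, hO, fun p ε₀ ε₁ hε₁ V hV => ⟨?_, ?_⟩⟩
  · intro hε₀ hB₃ε
    have hε₁a : ε₁ ≤ C.a₁ := by
      have h : B₃ * T.κ₀ * ε₁ ≤ B₃ * T.κ₀ * C.a₁ := hB₃ε.trans (hε₀.trans (min_le_right _ _))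
      exact le_of_mul_le_mul_left h hBκ
    obtain ⟨U₀, h14⟩ := Hbg p.1 p.2 ε₁ hε₁ hε₁a V hV
    have hκε : 0 < T.κ₀ * ε₁ := mul_pos hκ₀pos hε₁
    have h := (H p.1 p.2 ε₀ (T.κ₀ * ε₁) hκε V (hRegT7 p.1 p.2 ε₁ V (hReg7T p.1 p.2 ε₁ V hV)) U₀ h14).1
      (hε₀.trans (min_le_left _ _)) (by nlinarith)
    exact h
  · intro hε₁a
    have hε₁C : ε₁ ≤ C.a₁ := hε₁a.trans (min_le_right _ _)
    have hε₁κ : T.κ₀ * ε₁ ≤ a₁' := by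
      have := (le_div_iff₀ hκ₀pos).1 (hε₁a.trans (min_le_left _ _))
      linarith [mul_comm T.κ₀ ε₁]
    obtain ⟨U₀, h14⟩ := Hbg p.1 p.2 ε₁ hε₁ hε₁C V hV
    have hκε : 0 < T.κ₀ * ε₁ := mul_pos hκ₀pos hε₁
    obtain ⟨U, hU⟩ := (H p.1 p.2 ε₀ (T.κ₀ * ε₁) hκε V (hRegT7 p.1 p.2 ε₁ V (hReg7T p.1 p.2 ε₁ V hV)) U₀ h14).2 hε₁κ
    refine ⟨U, ?_⟩
    have e : O * C₁ * (B₃ * T.κ₀) * ε₁ = O * C₁ * B₃ * (T.κ₀ * ε₁) := by ring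
    rw [e]
    exact hU

/-! ## §4. The B11 leaf of the repaired tower bundle at B₃″ = κ₀B₃ and the node N07 -/

/-- **THE B11 LEAF OF THE REPAIRED TOWER BUNDLE, AT B₃″ = κ₀B₃, FROM PRINTED PARTS AND LOCATED LEAVES ONLY.**  Theorem 1 by the repaired
induction (§2, fed with Props 2, 5, 6, 8, Sect. F at the Sect.-F constant B₃), Proposition 7 at B₃″ as its by-product (§3); the leaf's own
instances of Props 2, 3, 4, 5, 6, 8, Sect. F at B₃″ (hypotheses `q2 … qF`: the same B₃-generic typed statements at the second constant)
and Prop 9 enter verbatim.  Nothing of the series is asserted. [cite: Balaban1985Variational, Thm 1 p.279, Props 2–9 pp.281–309; Sect. A pp.279–280] -/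
theorem b11Leaf_towerT_of_parts (famAn : (Σ n, T.I n) → AnData) {B₀ B₁ B₃ B₅ C₁ C₂ C₃ c₁ c1h c₄ δ₀ β₀ O₁ O₂ e₅ : ℝ}
    (hbg14 : ∀ (p : Σ n, T.I n) (ε : ℝ) (V : (T.fam p.1 p.2).Bdry) (U : (T.fam p.1 p.2).Cfg),
      (T.fam p.1 p.2).Sat14 C₁ B₃ ε V U → (famD p).Sat14 (C₁ * B₃ * ε) (C₁ * ε) ((β p).bdry V) (bg p U))
    (laws : ∀ p, (β p).Laws C₁ B₃) (leaves : ∀ p, ExistenceLeavesCap (β p) B₀ B₃ C₁ O₁ O₂ e₅)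
    (cl : T.ClassLaws) (lawsA : ∀ n i, (T.fam n i).LawsA) (hA11 : StepA11T T) (hA13 : StepA13T T) (hK1 : BaseK1T T B₃ C₁)
    (hB₀ : 0 < B₀) (hB₁ : 0 < B₁) (hB₃ : 1 ≤ B₃) (hL : 1 ≤ T.L) (hC₁L : T.L ^ 3 ≤ C₁) (hC₁' : T.C₁' ≤ C₁)
    (hB₀B₁ : B₀ ≤ 4 * B₁) (hc₁ : 0 < c₁) (hO₁ : 0 < O₁) (hO₂ : 0 < O₂) (he₅ : 0 < e₅)
    (p2 : Prop2Printed B₁ B₃ C₁ c₁ famD) (p5 : Prop5Printed B₁ B₃ C₁ famD) (p6 : Prop6Printed B₀ B₃ C₁ famD)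
    (p8 : Prop8Printed B₃ T.famAllX) (sF : SectFPrinted B₃ T.famAllX)
    (q2 : Prop2Printed B₁ (B₃ * T.κ₀) C₁ c₁ famD) (q3 : Prop3Printed C₁ (B₃ * T.κ₀) C₂ C₃ B₀ c1h c₄ δ₀ famD)
    (q4 : Prop4Printed C₁ (B₃ * T.κ₀) famD) (q5 : Prop5Printed B₁ (B₃ * T.κ₀) C₁ famD)
    (q6 : Prop6Printed B₀ (B₃ * T.κ₀) C₁ famD) (q8 : Prop8Printed (B₃ * T.κ₀) T.famAllX) (qF : SectFPrinted (B₃ * T.κ₀) T.famAllX)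
    (p9 : Prop9Printed B₅ C₁ β₀ δ₀ famAn) :
    B11Leaf
      { I11 := (Σ n, T.I n), famV := T.famAll, famLG := famD, famX := T.famAllX, famAn := famAn, B₀ := B₀, B₁ := B₁,
        B₃ := B₃ * T.κ₀, B₅ := B₅, C₁ := C₁, C₂ := C₂, C₃ := C₃, c₁ := c₁, c1h := c1h, c₄ := c₄, δ₀ := δ₀, β₀ := β₀ } where
  t1 := thm1Printed_towerT_of_parts T famD β bg hbg14 laws leaves cl lawsA hA11 hA13 hK1 hB₀ hB₁ hB₃ hL hC₁L hC₁' hB₀B₁ hc₁ hO₁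
    hO₂ he₅ p2 p5 p6 p8 sF
  p2 := q2
  p3 := q3
  p4 := q4
  p5 := q5
  p6 := q6
  p7 := prop7Printed_towerT_of_parts T famD β bg hbg14 laws leaves cl lawsA hA11 hA13 hK1 hB₀ hB₁ hB₃ hL hC₁L hC₁' hB₀B₁ hc₁
    hO₁ hO₂ he₅ p2 p5 p6 p8 sF
  p8 := q8
  sF := qF
  p9 := p9

/-- **THE NODE N07 AT A RUN BOUND TO THE REPAIRED TOWER BUNDLE**: for every binding world and run with
`w.up P = Upstream.ofPrintedAllXPN X Y Z V W` whose B11 group `Z` IS the bundle of `b11Leaf_towerT_of_parts`, its inputs give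
`Dag.B11_main (leavesP w P)` («b5 → b6 → b7 → b8 → b9 → b11»; antecedents not consumed — `B11LeafKnit` §3 for the b8 edge).  Hypothesis list =
what a NODE-00 pin of the B11 group by the repaired scale tower must carry for N07; nothing is discharged here.
[cite: Balaban1985Variational, Thm 1 p.279, Props 2–9 pp.281–309] -/
theorem b11_main_towerT_of_parts (w : WorldP) (P : B12.RunParams) (X : PrintedCarriersR) (Y : PrintedCarriers9X)
    (V : PrintedCarriers14R) (W : PrintedCarriers15) (famAn : (Σ n, T.I n) → AnData)
    {B₀ B₁ B₃ B₅ C₁ C₂ C₃ c₁ c1h c₄ δ₀ β₀ O₁ O₂ e₅ : ℝ}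
    (hP : w.up P = Upstream.ofPrintedAllXPN X Y
      { I11 := (Σ n, T.I n), famV := T.famAll, famLG := famD, famX := T.famAllX, famAn := famAn, B₀ := B₀, B₁ := B₁,
        B₃ := B₃ * T.κ₀, B₅ := B₅, C₁ := C₁, C₂ := C₂, C₃ := C₃, c₁ := c₁, c1h := c1h, c₄ := c₄, δ₀ := δ₀, β₀ := β₀ } V W)
    (hbg14 : ∀ (p : Σ n, T.I n) (ε : ℝ) (V : (T.fam p.1 p.2).Bdry) (U : (T.fam p.1 p.2).Cfg),
      (T.fam p.1 p.2).Sat14 C₁ B₃ ε V U → (famD p).Sat14 (C₁ * B₃ * ε) (C₁ * ε) ((β p).bdry V) (bg p U))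
    (laws : ∀ p, (β p).Laws C₁ B₃) (leaves : ∀ p, ExistenceLeavesCap (β p) B₀ B₃ C₁ O₁ O₂ e₅)
    (cl : T.ClassLaws) (lawsA : ∀ n i, (T.fam n i).LawsA) (hA11 : StepA11T T) (hA13 : StepA13T T) (hK1 : BaseK1T T B₃ C₁)
    (hB₀ : 0 < B₀) (hB₁ : 0 < B₁) (hB₃ : 1 ≤ B₃) (hL : 1 ≤ T.L) (hC₁L : T.L ^ 3 ≤ C₁) (hC₁' : T.C₁' ≤ C₁)
    (hB₀B₁ : B₀ ≤ 4 * B₁) (hc₁ : 0 < c₁) (hO₁ : 0 < O₁) (hO₂ : 0 < O₂) (he₅ : 0 < e₅)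
    (p2 : Prop2Printed B₁ B₃ C₁ c₁ famD) (p5 : Prop5Printed B₁ B₃ C₁ famD) (p6 : Prop6Printed B₀ B₃ C₁ famD)
    (p8 : Prop8Printed B₃ T.famAllX) (sF : SectFPrinted B₃ T.famAllX)
    (q2 : Prop2Printed B₁ (B₃ * T.κ₀) C₁ c₁ famD) (q3 : Prop3Printed C₁ (B₃ * T.κ₀) C₂ C₃ B₀ c1h c₄ δ₀ famD)
    (q4 : Prop4Printed C₁ (B₃ * T.κ₀) famD) (q5 : Prop5Printed B₁ (B₃ * T.κ₀) C₁ famD)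
    (q6 : Prop6Printed B₀ (B₃ * T.κ₀) C₁ famD) (q8 : Prop8Printed (B₃ * T.κ₀) T.famAllX) (qF : SectFPrinted (B₃ * T.κ₀) T.famAllX)
    (p9 : Prop9Printed B₅ C₁ β₀ δ₀ famAn) :
    Dag.B11_main (leavesP w P) := by
  show (w.up P).b5 → (w.up P).b6 → (w.up P).b7 → (w.up P).b8 → (w.up P).b9 → (w.up P).b11
  rw [hP]
  exact fun _ _ _ _ _ => b11Leaf_towerT_of_parts T famD β bg famAn hbg14 laws leaves cl lawsA hA11 hA13 hK1 hB₀ hB₁ hB₃ hL hC₁L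
    hC₁' hB₀B₁ hc₁ hO₁ hO₂ he₅ p2 p5 p6 p8 sF q2 q3 q4 q5 q6 q8 qF p9

end Literature.MathematicalPhysics.QuantumFieldTheory.Balaban1983to89.B11LeafKnitTwoTier
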